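import Mathlib

/-!
# Crux `ChessboardParticlePlanes.LjBilayerHcp` (stmt-AtomisticToContinuum-6710), line `Sketch` —
# elementary lemmas for the one-dimensional reduction of the numeric stub

Helper file (pure real analysis, `[folklore]`) for `ChessboardParticlePlanesLjBilayerHcpNumericReduction.lean`:
the planar form `Q(k,i,j) = i² + ij + j² + [k odd](i + j + 1/3)` of the `ℤ³`-indexed hcp energy series
(`ExcessDecayLiouvilleCoarseGrains.hcpEnergySeries_of_eq`) is non-negative, `≥ 1/3` on odd layers and `≥ 1`
on the punctured even layer `k = 0`, so that `Q v + k²t² ≥ min 1 (min (1/3 + t²) (4t²))` for `v ≠ 0`; the AM–GM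
step `A u² − B u ≥ −B²/(4A)`; the sixth root with `a⁶ = X`; splitting a `tsum` over `ℤ³` into a box `Finset`
sum and the indicator of the complement.  No definitions are introduced.
-/

noncomputable section

open scoped BigOperators

namespace Summit.AtomisticToContinuum.Crystallization.Theorems.LjBilayerHcpSketch

/-! ## The planar form -/

/-- `4(i² + ij + j² + i + j) + 1 = (2i + j + 1)² + j(3j + 2) ≥ 0`, hence the integer `i² + ij + j² + i + j`
is `≥ 0`. [folklore] -/
theorem int_oddForm_nonneg (i j : ℤ) : 0 ≤ i ^ 2 + i * j + j ^ 2 + i + j := by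
  have h1 : 0 ≤ j * (3 * j + 2) := by
    rcases le_or_gt 0 j with hj | hj
    · exact mul_nonneg hj (by linarith)
    · exact mul_nonneg_of_nonpos_of_nonpos hj.le (by linarith)
  nlinarith [sq_nonneg (2 * i + j + 1)]

/-- The odd-layer planar form is `≥ 1/3`: `i² + ij + j² + i + j + 1/3 ≥ 1/3`. [folklore] -/
theorem oddForm_ge_third (i j : ℤ) :
    (1 : ℝ) / 3 ≤ (i : ℝ) ^ 2 + (i : ℝ) * j + (j : ℝ) ^ 2 + ((i : ℝ) + j + 1 / 3) := by
  have h := int_oddForm_nonneg i j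
  have h' : (0 : ℝ) ≤ (i : ℝ) ^ 2 + (i : ℝ) * j + (j : ℝ) ^ 2 + i + j := by exact_mod_cast h
  linarith

/-- The even-layer planar form is `≥ 1` off the origin: `i² + ij + j² ≥ 1` for `(i, j) ≠ (0, 0)`. [folklore] -/
theorem evenForm_ge_one {i j : ℤ} (h : ¬ (i = 0 ∧ j = 0)) :
    (1 : ℝ) ≤ (i : ℝ) ^ 2 + (i : ℝ) * j + (j : ℝ) ^ 2 := by
  have key : (1 : ℤ) ≤ i ^ 2 + i * j + j ^ 2 := by
    by_cases hj : j = 0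
    · subst hj
      have hi : i ≠ 0 := fun hi => h ⟨hi, rfl⟩
      have : 0 < i ^ 2 := by positivity
      nlinarith
    · have : 0 < j ^ 2 := by positivity
      nlinarith [sq_nonneg (2 * i + j)]
  exact_mod_cast key

/-- The even-layer planar form is `≥ 0`. [folklore] -/
theorem evenForm_nonneg (i j : ℤ) : (0 : ℝ) ≤ (i : ℝ) ^ 2 + (i : ℝ) * j + (j : ℝ) ^ 2 := by
  nlinarith [sq_nonneg ((2 : ℝ) * i + j), sq_nonneg (j : ℝ)]

/-- **`Q ≥ 0`.** [folklore] -/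
theorem planarForm_nonneg (v : ℤ × ℤ × ℤ) :
    (0 : ℝ) ≤ (v.2.1 : ℝ) ^ 2 + (v.2.1 : ℝ) * v.2.2 + (v.2.2 : ℝ) ^ 2 +
      (if Even v.1 then 0 else ((v.2.1 : ℝ) + v.2.2 + 1 / 3)) := by
  split_ifs
  · rw [add_zero]; exact evenForm_nonneg _ _
  · linarith [oddForm_ge_third v.2.1 v.2.2]

/-- **The squared norms are bounded below off the origin**: for `v = (k,i,j) ≠ 0` and `t > 0`,
`Q v + k² t² ≥ min 1 (min (1/3 + t²) (4 t²))` (`k = 0`: `Q ≥ 1`; `k` odd: `Q ≥ 1/3`, `k² ≥ 1`; `k ≠ 0` even: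
`k² ≥ 4`). [folklore] -/
theorem rho_le_base {v : ℤ × ℤ × ℤ} (hv : v ≠ 0) {t : ℝ} (ht : 0 < t) :
    min 1 (min (1 / 3 + t ^ 2) (4 * t ^ 2)) ≤
      (v.2.1 : ℝ) ^ 2 + (v.2.1 : ℝ) * v.2.2 + (v.2.2 : ℝ) ^ 2 +
        (if Even v.1 then 0 else ((v.2.1 : ℝ) + v.2.2 + 1 / 3)) + (v.1 : ℝ) ^ 2 * t ^ 2 := by
  obtain ⟨k, i, j⟩ := v
  dsimp only
  have ht2 : 0 < t ^ 2 := by positivity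
  by_cases hk : Even k
  · rw [if_pos hk, add_zero]
    by_cases hk0 : k = 0
    · subst hk0
      have hij : ¬ (i = 0 ∧ j = 0) := by
        rintro ⟨rfl, rfl⟩; exact hv rfl
      have h1 := evenForm_ge_one hij
      calc min 1 (min (1 / 3 + t ^ 2) (4 * t ^ 2)) ≤ 1 := min_le_left _ _
        _ ≤ _ := by push_cast; nlinarith
    · -- `k` even, `k ≠ 0`: `|k| ≥ 2`
      obtain ⟨m, rfl⟩ := hk
      have hm : m ≠ 0 := by rintro rfl; exact hk0 (by simp)
      have hm1 : (1 : ℝ) ≤ (m : ℝ) ^ 2 := by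
        have : (1 : ℤ) ≤ m ^ 2 := by
          have : 0 < m ^ 2 := by positivity
          linarith
        exact_mod_cast this
      have hQ := evenForm_nonneg i j
      calc min 1 (min (1 / 3 + t ^ 2) (4 * t ^ 2)) ≤ 4 * t ^ 2 :=
            (min_le_right _ _).trans (min_le_right _ _)
        _ ≤ _ := by push_cast; nlinarith
  · rw [if_neg hk]
    have hk1 : (1 : ℝ) ≤ (k : ℝ) ^ 2 := by
      have hk0 : k ≠ 0 := by rintro rfl; exact hk (by simp)
      have : (1 : ℤ) ≤ k ^ 2 := by
        have : 0 < k ^ 2 := by positivity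
        linarith
      exact_mod_cast this
    have hQ := oddForm_ge_third i j
    calc min 1 (min (1 / 3 + t ^ 2) (4 * t ^ 2)) ≤ 1 / 3 + t ^ 2 :=
          (min_le_right _ _).trans (min_le_left _ _)
      _ ≤ _ := by nlinarith


/-- **Registered sub-goal `numericAux_rho_le_base` (anchor of this helper file):** for `v = (k,i,j) ≠ 0` and `t > 0`,
`Q v + k² t² ≥ min 1 (min (1/3 + t²) (4 t²))`, binder-free spelling of `rho_le_base`. [folklore] -/
theorem numericAux_rho_le_base :
    ∀ (v : ℤ × ℤ × ℤ), v ≠ 0 → ∀ (t : ℝ), 0 < t →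
      min 1 (min (1 / 3 + t ^ 2) (4 * t ^ 2)) ≤
        (v.2.1 : ℝ) ^ 2 + (v.2.1 : ℝ) * v.2.2 + (v.2.2 : ℝ) ^ 2 +
          (if Even v.1 then 0 else ((v.2.1 : ℝ) + v.2.2 + 1 / 3)) + (v.1 : ℝ) ^ 2 * t ^ 2 :=
  fun _ hv _ ht => rho_le_base hv ht

/-- The lower bound `min 1 (min (1/3 + t²) (4t²))` is positive for `t > 0`. [folklore] -/
theorem rho_pos {t : ℝ} (ht : 0 < t) : 0 < min 1 (min (1 / 3 + t ^ 2) (4 * t ^ 2)) :=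
  lt_min one_pos (lt_min (by positivity) (by positivity))

/-! ## One-variable calculus -/

/-- **AM–GM / completing the square**: `A u² − B u ≥ −B²/(4A)` for `A > 0`. [folklore] -/
theorem quad_lower_bound {A : ℝ} (hA : 0 < A) (B u : ℝ) : -(B ^ 2 / (4 * A)) ≤ A * u ^ 2 - B * u := by
  have h : 0 ≤ A * (u - B / (2 * A)) ^ 2 := by positivity
  have hA' : A ≠ 0 := hA.ne'
  have expand : A * (u - B / (2 * A)) ^ 2 = A * u ^ 2 - B * u + B ^ 2 / (4 * A) := by
    field_simp
    ring
  linarith [expand ▸ h]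

/-- **Sixth root**: for `X > 0` there is `a > 0` with `a⁶ = X`. [folklore] -/
theorem exists_pow_six_eq {X : ℝ} (hX : 0 < X) : ∃ a : ℝ, 0 < a ∧ a ^ 6 = X := by
  refine ⟨X ^ ((1 : ℝ) / 6), Real.rpow_pos_of_pos hX _, ?_⟩
  rw [← Real.rpow_natCast, ← Real.rpow_mul hX.le]
  norm_num

/-- If `c⁶ ≤ a⁶ ≤ d⁶` with `a, d ≥ 0` then `c ≤ a ≤ d`. [folklore] -/
theorem le_and_le_of_pow_six {a c d : ℝ} (ha : 0 ≤ a) (hd : 0 ≤ d)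
    (h1 : c ^ 6 ≤ a ^ 6) (h2 : a ^ 6 ≤ d ^ 6) : c ≤ a ∧ a ≤ d :=
  ⟨le_of_pow_le_pow_left₀ (by norm_num) ha h1, le_of_pow_le_pow_left₀ (by norm_num) hd h2⟩

/-! ## Sums over `ℤ³`: box part and complement -/

/-- **Splitting a summable family over `ℤ³` at a finite index set**:
`∑' v, f v = ∑_{v ∈ I} f v + ∑' v, (if v ∈ I then 0 else f v)`. [folklore] -/
theorem tsum_eq_sum_add_tsum_ite {f : ℤ × ℤ × ℤ → ℝ} (hf : Summable f) (I : Finset (ℤ × ℤ × ℤ)) :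
    ∑' v, f v = (∑ v ∈ I, f v) + ∑' v, (if v ∈ I then 0 else f v) := by
  classical
  have h1 : ∀ v, f v = (if v ∈ I then f v else 0) + (if v ∈ I then 0 else f v) := by
    intro v; split_ifs <;> simp
  have hs1 : Summable fun v => if v ∈ I then f v else 0 := by
    apply summable_of_ne_finset_zero (s := I)
    intro v hv; rw [if_neg hv]
  have hs2 : Summable fun v => if v ∈ I then 0 else f v := by
    have : (fun v => if v ∈ I then 0 else f v) = fun v => f v - (if v ∈ I then f v else 0) := by
      funext v; split_ifs <;> simp
    rw [this]; exact hf.sub hs1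
  calc ∑' v, f v = ∑' v, ((if v ∈ I then f v else 0) + (if v ∈ I then 0 else f v)) :=
        tsum_congr h1
    _ = (∑' v, (if v ∈ I then f v else 0)) + ∑' v, (if v ∈ I then 0 else f v) :=
        hs1.tsum_add hs2
    _ = (∑ v ∈ I, f v) + ∑' v, (if v ∈ I then 0 else f v) := by
        congr 1
        rw [tsum_eq_sum (s := I) (fun v hv => if_neg hv)]
        exact Finset.sum_congr rfl fun v hv => if_pos hv

/-- The complement indicator of a summable family is summable. [folklore] -/
theorem summable_ite_compl {f : ℤ × ℤ × ℤ → ℝ} (hf : Summable f) (I : Finset (ℤ × ℤ × ℤ)) :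
    Summable fun v => if v ∈ I then 0 else f v := by
  classical
  have hs1 : Summable fun v => if v ∈ I then f v else 0 := by
    apply summable_of_ne_finset_zero (s := I)
    intro v hv; rw [if_neg hv]
  have : (fun v => if v ∈ I then 0 else f v) = fun v => f v - (if v ∈ I then f v else 0) := by
    funext v; split_ifs <;> simp
  rw [this]; exact hf.sub hs1

/-- **A box sum is below the full sum** of a non-negative summable family. [folklore] -/
theorem sum_le_tsum_of_nonneg {f : ℤ × ℤ × ℤ → ℝ} (hf : Summable f) (h0 : ∀ v, 0 ≤ f v)
    (I : Finset (ℤ × ℤ × ℤ)) : ∑ v ∈ I, f v ≤ ∑' v, f v := by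
  rw [tsum_eq_sum_add_tsum_ite hf I]
  have : 0 ≤ ∑' v, (if v ∈ I then 0 else f v) :=
    tsum_nonneg fun v => by split_ifs <;> simp [h0 v]
  linarith

/-- Membership in the index box `Icc (-K) K ×ˢ (Icc (-N) N ×ˢ Icc (-N) N)` is the conjunction of the three
absolute-value bounds. [folklore] -/
theorem mem_box_iff (K N : ℤ) (v : ℤ × ℤ × ℤ) :
    v ∈ Finset.Icc (-K) K ×ˢ (Finset.Icc (-N) N ×ˢ Finset.Icc (-N) N) ↔
      (|v.1| ≤ K ∧ |v.2.1| ≤ N ∧ |v.2.2| ≤ N) := by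
  simp only [Finset.mem_product, Finset.mem_Icc, abs_le]

end Summit.AtomisticToContinuum.Crystallization.Theorems.LjBilayerHcpSketch

end
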